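import Mathlib

/-!
# Single-row indicators have Fourier level `≤ 1` (stub `stub_rowFix`)

Line `SketchIdeator3G2` for the crux `LevelGradedCohnUmans.SubgroupIdentityDesigns`
(`stmt-MatrixMultiplication-14079`).

For `i : Fin m` the indicator of `{g ∈ GL_m(𝔽_p) : row i of g is the unit row e_iᵀ}` is a
combination of the characters `g ↦ ψ(tr(M g))` (`ψ = ZMod.stdAddChar`) over matrices `M` of rank
`≤ 1`.  Proof: by orthogonality of `ψ` on `𝔽_p^m`,
`[e_iᵀ g = e_iᵀ] = p^{-m} Σ_{v ∈ 𝔽_p^m} ψ(v ⬝ (e_iᵀ g − e_iᵀ))`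
`= p^{-m} Σ_v ψ(−v_i) ψ(tr((v e_iᵀ) g))`,
and the modes `v e_iᵀ = Matrix.vecMulVec v (Pi.single i 1)` have rank `≤ 1`
(`Matrix.rank_vecMulVec_le`).  The coefficient table is
`c M = Σ_v [M = v e_iᵀ] p^{-m} ψ(−v_i)`, which vanishes off the modes.
-/

-- single-conjunct summit: namespace repeats MatrixMultiplication (summit = sub-problem)
set_option linter.dupNamespace false

noncomputable section

open scoped BigOperators Classical

namespace Summit.MatrixMultiplication.MatrixMultiplication.Theorems.Witnessed

variable {p m : ℕ} [Fact p.Prime]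

/-- Orthogonality of `ψ = ZMod.stdAddChar` on `𝔽_p^m`: `Σ_ξ ψ(ξ ⬝ w) = p^m [w = 0]`. -/
private theorem sum_stdAddChar_dotProduct (w : Fin m → ZMod p) :
    ∑ ξ : Fin m → ZMod p, ZMod.stdAddChar (ξ ⬝ᵥ w) =
      if w = 0 then (p : ℂ) ^ m else 0 := by
  -- adapted from `Literature.Computability.AlgebraicComplexity.LineSTPP.sum_dotProduct_eq`
  split_ifs with hw
  · subst hw
    simp only [dotProduct_zero, AddChar.map_zero_eq_one, Finset.sum_const, Finset.card_univ,
      Fintype.card_pi, Finset.prod_const, ZMod.card, Fintype.card_fin, nsmul_eq_mul, mul_one,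
      Nat.cast_pow]
  · obtain ⟨l, hl⟩ : ∃ l, w l ≠ 0 := Function.ne_iff.mp hw
    let L : (Fin m → ZMod p) →+ ZMod p :=
      { toFun := fun ξ => ξ ⬝ᵥ w
        map_zero' := zero_dotProduct w
        map_add' := fun x y => add_dotProduct x y w }
    let Ψ : AddChar (Fin m → ZMod p) ℂ := (ZMod.stdAddChar (N := p)).compAddMonoidHom L
    have hΨ : Ψ ≠ 1 := by
      have h1 : (ZMod.stdAddChar (N := p)).mulShift (w l) ≠ 1 := ZMod.isPrimitive_stdAddChar p hl
      obtain ⟨s, hs⟩ := AddChar.ne_one_iff.1 h1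
      refine AddChar.ne_one_iff.2 ⟨Pi.single l s, ?_⟩
      rw [AddChar.mulShift_apply] at hs
      simpa [Ψ, L, single_dotProduct, mul_comm] using hs
    simpa [Ψ, L] using AddChar.sum_eq_zero_of_ne_one hΨ

/-- The modes are `v e_iᵀ = Matrix.vecMulVec v (Pi.single i 1)` (column `i` equals `v`, every
other column vanishes), and `tr((v e_iᵀ) G) = v ⬝ (row i of G)`. -/
private theorem trace_vecMulVec_single_mul {R : Type*} [CommRing R] (i : Fin m)
    (v : Fin m → R) (G : Matrix (Fin m) (Fin m) R) :
    Matrix.trace (Matrix.vecMulVec v (Pi.single i 1) * G) = v ⬝ᵥ G i := by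
  rw [Matrix.vecMulVec_mul, Matrix.trace_vecMulVec, Matrix.single_vecMul, one_smul,
    Matrix.row_apply']

/-- The coefficient table `c M = Σ_v [M = v e_iᵀ] p^{-m} ψ(−v_i)` vanishes on matrices of
rank `> 1` (`Matrix.rank_vecMulVec_le`). -/
private theorem rowCoeff_eq_zero (i : Fin m) (M : Matrix (Fin m) (Fin m) (ZMod p))
    (hM : 1 < M.rank) :
    (∑ v : Fin m → ZMod p, if M = Matrix.vecMulVec v (Pi.single i 1) then
        ((p : ℂ)⁻¹) ^ m * ZMod.stdAddChar (-(v i)) else 0) = 0 := by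
  refine Finset.sum_eq_zero fun v _ => if_neg ?_
  rintro rfl
  exact absurd (Matrix.rank_vecMulVec_le v (Pi.single i (1 : ZMod p))) (not_le.mpr hM)

/-- The row-indicator expansion for an arbitrary matrix `G`:
`[∀ j, G i j = δ_ij] = Σ_M c M ψ(tr(M G))` with the coefficient table
`c M = Σ_v [M = v e_iᵀ] p^{-m} ψ(−v_i)`. -/
private theorem rowFix_expansion (i : Fin m) (G : Matrix (Fin m) (Fin m) (ZMod p)) :
    (if ∀ j : Fin m, G i j = (1 : Matrix (Fin m) (Fin m) (ZMod p)) i j then (1 : ℂ) else 0) =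
      ∑ M : Matrix (Fin m) (Fin m) (ZMod p),
        (∑ v : Fin m → ZMod p, if M = Matrix.vecMulVec v (Pi.single i 1) then
            ((p : ℂ)⁻¹) ^ m * ZMod.stdAddChar (-(v i)) else 0) *
          ZMod.stdAddChar (Matrix.trace (M * G)) := by
  -- Step 1: collapse the double sum onto the modes `v e_iᵀ`
  have step1 : ∑ M : Matrix (Fin m) (Fin m) (ZMod p),
      (∑ v : Fin m → ZMod p, if M = Matrix.vecMulVec v (Pi.single i 1) then
          ((p : ℂ)⁻¹) ^ m * ZMod.stdAddChar (-(v i)) else 0) *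
        ZMod.stdAddChar (Matrix.trace (M * G)) =
        ∑ v : Fin m → ZMod p, ((p : ℂ)⁻¹) ^ m * (ZMod.stdAddChar (-(v i)) *
          ZMod.stdAddChar (Matrix.trace (Matrix.vecMulVec v (Pi.single i 1) * G))) := by
    simp only [Finset.sum_mul, ite_mul, zero_mul]
    rw [Finset.sum_comm]
    refine Finset.sum_congr rfl fun v _ => ?_
    rw [Fintype.sum_ite_eq' (Matrix.vecMulVec v (Pi.single i 1)), mul_assoc]
  -- Step 2: combine the two characters, `ψ(-v_i) ψ(v ⬝ G i) = ψ(v ⬝ (G i - e_i))`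
  have step2 : ∀ v : Fin m → ZMod p, ZMod.stdAddChar (-(v i)) *
      ZMod.stdAddChar (Matrix.trace (Matrix.vecMulVec v (Pi.single i 1) * G)) =
        ZMod.stdAddChar (v ⬝ᵥ fun a => G i a - (1 : Matrix (Fin m) (Fin m) (ZMod p)) i a) := by
    intro v
    rw [trace_vecMulVec_single_mul, ← AddChar.map_add_eq_mul]
    congr 1
    have e : (fun a => G i a - (1 : Matrix (Fin m) (Fin m) (ZMod p)) i a) =
        G i - Pi.single i 1 := by
      funext a
      simp only [Pi.sub_apply, Matrix.one_eq_pi_single]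
    rw [e, dotProduct_sub, dotProduct_single_one]
    ring
  rw [step1]
  simp_rw [step2]
  rw [← Finset.mul_sum, sum_stdAddChar_dotProduct]
  -- Step 3: compare the two indicators
  have hp : (p : ℂ) ≠ 0 := Nat.cast_ne_zero.mpr (Fact.out : p.Prime).ne_zero
  by_cases h : ∀ j : Fin m, G i j = (1 : Matrix (Fin m) (Fin m) (ZMod p)) i j
  · have h0 : (fun a => G i a - (1 : Matrix (Fin m) (Fin m) (ZMod p)) i a) = 0 := by
      funext a
      simp [h a]
    rw [if_pos h, h0, if_pos rfl, ← mul_pow, inv_mul_cancel₀ hp, one_pow]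
  · have h0 : (fun a => G i a - (1 : Matrix (Fin m) (Fin m) (ZMod p)) i a) ≠ 0 := by
      intro h0
      exact h fun j => sub_eq_zero.mp (congr_fun h0 j)
    rw [if_neg h, if_neg h0, mul_zero]

/-- **Single-row indicator** (stub `stub_rowFix`).  For `i : Fin m`, the indicator of
`{g ∈ GL_m(𝔽_p) : row i of g is the unit row e_iᵀ}` has Fourier level `≤ 1`: it equals
`Σ_M c_M ψ(tr(M g))` (`ψ = ZMod.stdAddChar`) with `c` supported on matrices of rank `≤ 1`
(the modes `v e_iᵀ`, `c_{v e_iᵀ} = p^{-m} ψ(−v_i)`). -/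
theorem stub_rowFix (i : Fin m) :
    ∃ c : Matrix (Fin m) (Fin m) (ZMod p) → ℂ, (∀ M, 1 < M.rank → c M = 0) ∧
      ∀ g : Matrix.GeneralLinearGroup (Fin m) (ZMod p),
        (if ∀ j : Fin m, (g : Matrix (Fin m) (Fin m) (ZMod p)) i j =
            (1 : Matrix (Fin m) (Fin m) (ZMod p)) i j then (1 : ℂ) else 0) =
          ∑ M : Matrix (Fin m) (Fin m) (ZMod p),
            c M * ZMod.stdAddChar (Matrix.trace (M * (g : Matrix (Fin m) (Fin m) (ZMod p)))) := by
  refine ⟨fun M => ∑ v : Fin m → ZMod p, if M = Matrix.vecMulVec v (Pi.single i 1) then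
      ((p : ℂ)⁻¹) ^ m * ZMod.stdAddChar (-(v i)) else 0, rowCoeff_eq_zero i, fun g => ?_⟩
  exact rowFix_expansion i (g : Matrix (Fin m) (Fin m) (ZMod p))

end Summit.MatrixMultiplication.MatrixMultiplication.Theorems.Witnessed

end
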